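import Summits.CriticalPhenomena.PercolationContinuityZ3.Theorems.Transplant.FKDoubleFanMultifanFinal
import Summits.CriticalPhenomena.PercolationContinuityZ3.Theorems.Transplant.FKDoubleFanSesquiCone
import HarnessLib

/-!
# Double fans `K₂ ∨ P_{m+1}`: the MULTIFAN₁ CONE — the closed cone of the images of ALL `a`-fan-then-`b`-fan middles — and the reduction of
# the far cross-apex theorem for EVERY middle to ONE stability statement: an `a`-SPOKE keeps the MULTIFAN₁ cone invariant

Helper file (`--supports stmt-CriticalPhenomena-4575`), FK sub-lane `prim-bschramm-fk-3` (gen 44); builds on p205010 (kernel theorem, internal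
audit signed; external expert review pending).  No named facts, no sorries; standard axioms.  Memo `bschramm/prim-bschramm-fk-3/FAR-CROSS-XIX.md` §2.

THE OBSERVATION.  `…MultifanFinal` proves the four-leg inequality `mfZ¹⁰mfZ⁰¹ − mfZ¹¹mfZ⁰⁰ ≥ 0` on `InKE⁴`, i.e. (**`pairH_imgAB_target`**) every
MULTIFAN₁ image **`imgAB q F G u`** `= (G_b F_a (AC_0∗u)) ∧ (G_b F_a (AC_1∗u))` (`a`-gadget `F`, then `b`-gadget `G`, both with `InKE` coefficient
vectors, input `u ∈ InKE`) pairs `≥ 0` with every target `(s∗BC_0) ∧ (s∗BC_1)`.  Let **`coneAB q`** be the closed convex cone bi-dual to these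
images (dual **`DualAB q`**).  Then, UNCONDITIONALLY:
* targets lie in `DualAB q` (**`target_dualAB`**, `0 < q ≤ 1`) — this IS the MULTIFAN₁ theorem;
* inputs lie in `coneAB q` (`F = G = fanInit`, **`input_mem_coneAB`**);
* `coneAB q` is stable under `b`-spokes AND rim steps for free — both letters are absorbed into the `b`-gadget:
  `BC_y ∗ (G_b X) = (BC_y∗G)_b X`, `E_r (G_b X) = (E_r G)_b X` (**`opBC_imgAB`**, **`opE_imgAB`**, **`DualAB.bc`**, **`DualAB.rim`**).
So the ONLY letter not absorbed is the `a`-spoke, and (**`isLetterCone_coneAB`**) under the single hypothesis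
**`HypAC q`**: `∧²AC_x · imgAB q F G u ∈ coneAB q` (`F, G, u ∈ InKE q`, `x ∈ [0,1]`)
the MULTIFAN₁ cone is a letter cone, whence (**`rayleigh_crossFar_of_hypAC`**, **`negCorr_spokes_cross_far_of_hypAC`**) negative correlation
`φ(J_{a c_j} ∩ J_{b c_k}) ≤ φ(J_{a c_j})·φ(J_{b c_k})` for EVERY weighted double fan, every `j < k`, every middle — with no positivity lemma
beyond the already proved MULTIFAN₁ inequality.  Equivalently: the closed cone of MULTIFAN₁ word images contains every word image.
FIRST-ORDER FORM.  Since `∧²AC_x = (1−x)²I + x(1−x)T_a + x²W_a` with `T_a` DIAGONAL (Plücker weights `0,1,0,1,1,0,1,1,2,1`) and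
`W_a β = β_yv·e_yv`, `e_yv ∈ coneAB` (**`eyv_mem_coneAB`**: it is the `a`-image `imgA q e_bc u` of a `ŷ = 0` input), `HypAC` is the statement
that the diagonal operator `T_a` is cross-positive on `coneAB` — i.e. that `coneAB` is invariant under the scaling `(y, v) ↦ (λy, λv)`,
`λ ≥ 1`, of the two hat coordinates of the plane `Π_a`.
STATUS of `HypAC`: OPEN; conjectural; supported by the guarded cutting-plane numerics of the memo (§2: membership of `∧²AC_x·imgAB`,
`∧²AC_x·imgB`, `∧²E_r∧²AC_x·imgB` and random words in `coneAB` at `q ∈ {.05,.2,.5,.8}`; LP test of the local criterion for `T_a` at `imgAB`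
generators; exact product-form separation LP finds no separator) — NOT to be built upon with certificate files before the memo's test protocol
is complete.  Relation to `…SesquiCone`: `cone15 ⊆ coneAB` needs `∧²AC_x·imgB ∈ coneAB` (an instance of `HypAC`); under `Hyp15` or `HypAC`
both cones equal the true cone of all word images.
[cite: Grimmett2006, §3.9 eq. (3.94) (pp. 63–64)] [folklore]
-/

noncomputable section

namespace Summit.CriticalPhenomena.PercolationContinuityZ3.Theorems

namespace FK

namespace ThreeApex

/-! ### MULTIFAN₁ images -/

/-- **The MULTIFAN₁ image**: the pair bivector after an `a`-gadget `F` and then a `b`-gadget `G` applied to the input pair `(AC_0∗u, AC_1∗u)`. [folklore] -/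
def imgAB (q : ℝ) (F G u : V5) : Biv :=
  wedgeH (fanComboB q G (fanCombo q F (conv (edgeAC 0) u))) (fanComboB q G (fanCombo q F (conv (edgeAC 1) u)))

/-- With both gadgets trivial the MULTIFAN₁ image is the input. [folklore] -/
theorem imgAB_init (q : ℝ) (u : V5) : imgAB q fanInit fanInit u = wedgeH (conv (edgeAC 0) u) (conv (edgeAC 1) u) := by
  simp only [imgAB, fanComboB_init, fanCombo_init]

/-- A `b`-spoke is absorbed into the `b`-gadget: `∧²BC_y · imgAB q F G u = imgAB q F (BC_y ∗ G) u`. [folklore] -/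
theorem opBC_imgAB (q y : ℝ) (F G u : V5) : opBC y (imgAB q F G u) = imgAB q F (conv (edgeBC y) G) u := by
  simp only [imgAB, opBC_wedgeH, conv_edgeBC_fanComboB]

/-- A rim step is absorbed into the `b`-gadget: `∧²E_r · imgAB q F G u = imgAB q F (E_r G) u`. [folklore] -/
theorem opE_imgAB (q r : ℝ) (F G u : V5) : opE q r (imgAB q F G u) = imgAB q F (rimStep q r G) u := by
  simp only [imgAB, opE_wedgeH, rimStep_fanComboB]

/-- **The four-leg Rayleigh difference is the pairing of the MULTIFAN₁ image with the target**:
`mfZ¹⁰mfZ⁰¹ − mfZ¹¹mfZ⁰⁰ = q²·⟪imgAB q F G u, (s∗BC_0)∧(s∗BC_1)⟫`. [cite: Grimmett2006, §3.9 eq. (3.94) (pp. 63–64)] -/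
theorem mfRay_eq_pairH_imgAB (q : ℝ) (F G u s : V5) :
    mfZ q F G u s 1 0 * mfZ q F G u s 0 1 - mfZ q F G u s 1 1 * mfZ q F G u s 0 0 =
      q ^ 2 * pairH q (imgAB q F G u) (wedgeH (conv s (edgeBC 0)) (conv s (edgeBC 1))) := by
  have e : ∀ (τ : ℝ) (X : V5), conv s (conv (edgeBC τ) X) = conv (conv s (edgeBC τ)) X := by
    intro τ X; simp only [← mul_def]; ac_rfl
  simp only [mfZ, imgAB, e]
  rw [← rayleigh_eq_pairH']

/-- **MULTIFAN₁ images pair non-negatively with every target** (`0 < q ≤ 1`; all four legs in `InKE q`) — `mfRay_nonneg_inKE`. [folklore] -/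
theorem pairH_imgAB_target {q : ℝ} (hq0 : 0 < q) (hq1 : q ≤ 1) {F G u s : V5} (hF : InKE q F) (hG : InKE q G) (hu : InKE q u)
    (hs : InKE q s) : 0 ≤ pairH q (imgAB q F G u) (wedgeH (conv s (edgeBC 0)) (conv s (edgeBC 1))) := by
  have h := mfRay_nonneg_inKE hq0 hq1 F G u s hF hG hu hs
  rw [mfRay_eq_pairH_imgAB] at h
  exact nonneg_of_mul_nonneg_right (by linarith [h]) (by positivity : (0 : ℝ) < q ^ 2)
    |> fun h' => by nlinarith [h, sq_nonneg q, mul_pos hq0 hq0]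

/-! ### The MULTIFAN₁ dual and bi-dual -/

/-- The dual of the MULTIFAN₁ images over `InKE`: bivectors pairing `≥ 0` with every `imgAB q F G u`, `F, G, u ∈ InKE q`. [folklore] -/
@[folklore] def DualAB (q : ℝ) (γ : Biv) : Prop := ∀ F G u : V5, InKE q F → InKE q G → InKE q u → 0 ≤ pairH q (imgAB q F G u) γ

/-- **The MULTIFAN₁ cone**: the closed convex cone bi-dual to the MULTIFAN₁ images. [folklore] -/
def coneAB (q : ℝ) : Set Biv := {β | ∀ γ : Biv, DualAB q γ → 0 ≤ pairH q β γ}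

/-- MULTIFAN₁ images lie in the MULTIFAN₁ cone. [folklore] -/
theorem imgAB_mem_coneAB {q : ℝ} {F G u : V5} (hF : InKE q F) (hG : InKE q G) (hu : InKE q u) : imgAB q F G u ∈ coneAB q :=
  fun _ hγ => hγ F G u hF hG hu

/-- **Inputs lie in the MULTIFAN₁ cone** (`u ∈ InKE q`). [folklore] -/
theorem input_mem_coneAB {q : ℝ} {u : V5} (hu : InKE q u) : wedgeH (conv (edgeAC 0) u) (conv (edgeAC 1) u) ∈ coneAB q := by
  rw [← imgAB_init]; exact imgAB_mem_coneAB (fanInit_inKE q) (fanInit_inKE q) hu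

/-- **Every target lies in the MULTIFAN₁ dual** (`0 < q ≤ 1`, `s ∈ InKE q`) — the MULTIFAN₁ theorem. [folklore] -/
theorem target_dualAB {q : ℝ} (hq0 : 0 < q) (hq1 : q ≤ 1) {s : V5} (hs : InKE q s) :
    DualAB q (wedgeH (conv s (edgeBC 0)) (conv s (edgeBC 1))) :=
  fun _ _ _ hF hG hu => pairH_imgAB_target hq0 hq1 hF hG hu hs

namespace DualAB

variable {q : ℝ} {γ : Biv}

/-- The MULTIFAN₁ dual is stable under `b`-spokes (unconditionally). [folklore] -/
theorem bc (hγ : DualAB q γ) {y : ℝ} (hy0 : 0 ≤ y) (hy1 : y ≤ 1) : DualAB q (opBC y γ) := fun F G u hF hG hu => by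
  rw [← pairH_opBC, opBC_imgAB]; exact hγ F _ u hF (InKE.step (IsLetter.bc hy0 hy1) hG) hu

/-- The MULTIFAN₁ dual is stable under rim steps (unconditionally). [folklore] -/
theorem rim (hγ : DualAB q γ) {r : ℝ} (hr0 : 0 ≤ r) (hr1 : r ≤ 1) : DualAB q (opE q r γ) := fun F G u hF hG hu => by
  rw [← pairH_opE, opE_imgAB]; exact hγ F _ u hF (InKE.rim hr0 hr1 hG) hu

end DualAB

/-- **`HypAC`**: an `a`-spoke keeps every MULTIFAN₁ image in the MULTIFAN₁ cone. [folklore] -/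
@[folklore] def HypAC (q : ℝ) : Prop :=
  ∀ (F G u : V5) (x : ℝ), InKE q F → InKE q G → InKE q u → 0 ≤ x → x ≤ 1 → opAC x (imgAB q F G u) ∈ coneAB q

/-- Under `HypAC` the MULTIFAN₁ dual is stable under `a`-spokes. [folklore] -/
theorem DualAB.ac {q : ℝ} {γ : Biv} (h : HypAC q) (hγ : DualAB q γ) {x : ℝ} (hx0 : 0 ≤ x) (hx1 : x ≤ 1) : DualAB q (opAC x γ) :=
  fun F G u hF hG hu => by rw [← pairH_opAC]; exact h F G u x hF hG hu hx0 hx1 γ hγ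

/-- **Under `HypAC` the MULTIFAN₁ cone is a letter cone.** [folklore] -/
theorem isLetterCone_coneAB {q : ℝ} (h : HypAC q) : IsLetterCone q (coneAB q) where
  zero_mem := fun γ _ => le_of_eq (pairH_zero_left q γ).symm
  add_mem := fun β γ hβ hγ δ hδ => by rw [pairH_add_left]; exact add_nonneg (hβ δ hδ) (hγ δ hδ)
  smul_mem := fun a β ha hβ δ hδ => by rw [pairH_smul_left]; exact mul_nonneg ha (hβ δ hδ)
  rim := fun r β hr0 hr1 hβ γ hγ => by rw [pairH_opE]; exact hβ _ (hγ.rim hr0 hr1)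
  ac := fun x β hx0 hx1 hβ γ hγ => by rw [pairH_opAC]; exact hβ _ (hγ.ac h hx0 hx1)
  bc := fun y β hy0 hy1 hβ γ hγ => by rw [pairH_opBC]; exact hβ _ (hγ.bc hy0 hy1)

/-- The MULTIFAN₁ cone pairs non-negatively with every target (`0 < q ≤ 1`). [folklore] -/
theorem pairH_coneAB_target {q : ℝ} (hq0 : 0 < q) (hq1 : q ≤ 1) {s : V5} (hs : InKE q s) :
    ∀ β, β ∈ coneAB q → 0 ≤ pairH q β (wedgeH (conv s (edgeBC 0)) (conv s (edgeBC 1))) :=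
  fun _ hβ => hβ _ (target_dualAB hq0 hq1 hs)

/-! ### The ray `e_yv` and the first-order form of `HypAC` -/

/-- The bivector `e_y ∧ e_v` of the plane `Π_a` (`W_a β = β_yv · e_yv`). [folklore] -/
def eyvBiv : Biv := ⟨0, 0, 0, 0, 0, 0, 0, 0, 1, 0⟩

/-- `W_a β = β_yv · e_yv`. [folklore] -/
theorem opWa_eq (β : Biv) : opWa β = Biv.smul β.yv eyvBiv := by
  ext <;> simp [opWa, eyvBiv, Biv.smul]

/-- The `a`-image of the gadget `e_bc = BC_1 E_0 fanInit` (detach, then contract `a` with the new vertex) at an input `u` with `Z₀ = Z_ac = 0` is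
`ẑ·|u| · e_yv`. [folklore] -/
theorem imgA_ebc_eq (q : ℝ) (u : V5) (h0 : u.z0 = 0) (hac : u.zac = 0) :
    imgA q ⟨0, 0, 0, 1, 0⟩ u = Biv.smul (hz u * u.total) eyvBiv := by
  ext <;> simp only [imgA, wedgeH, fanCombo, conv, edgeAC, detach, hx, hy, hz, V5.total, eyvBiv, Biv.smul, h0, hac] <;> ring

/-- **`e_yv` lies in the MULTIFAN₁ cone** (`0 < q ≤ 1`): it is (a positive multiple of) the `a`-image `imgA q e_bc e_bc`. [folklore] -/
theorem eyv_mem_coneAB (q : ℝ) : eyvBiv ∈ coneAB q := by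
  have hbc : InKE q (⟨0, 0, 0, 1, 0⟩ : V5) := by
    have : (⟨0, 0, 0, 1, 0⟩ : V5) = conv (edgeBC 1) delta0 := by ext <;> simp [conv, edgeBC, delta0, V5.total]
    rw [this]; exact InKE.step (IsLetter.bc zero_le_one le_rfl) InKE.base
  have himg : imgA q ⟨0, 0, 0, 1, 0⟩ ⟨0, 0, 0, 1, 0⟩ ∈ coneAB q := by
    have e : imgA q ⟨0, 0, 0, 1, 0⟩ ⟨0, 0, 0, 1, 0⟩ = imgAB q ⟨0, 0, 0, 1, 0⟩ fanInit ⟨0, 0, 0, 1, 0⟩ := by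
      simp only [imgA, imgAB, fanComboB_init]
    rw [e]; exact imgAB_mem_coneAB hbc (fanInit_inKE q) hbc
  rw [imgA_ebc_eq q _ rfl rfl] at himg
  have hc : hz (⟨0, 0, 0, 1, 0⟩ : V5) * V5.total ⟨0, 0, 0, 1, 0⟩ = 1 := by simp [hz, V5.total]
  rw [hc] at himg
  have e1 : Biv.smul 1 eyvBiv = eyvBiv := by ext <;> simp [Biv.smul]
  rwa [e1] at himg

/-- **First-order form, easy half**: under `HypAC`, at every MULTIFAN₁ image `g` and every dual element `γ` vanishing on `g`, `⟪T_a g, γ⟫ ≥ 0`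
(`T_a` is cross-positive on the generators of `coneAB`). [folklore] -/
theorem crossPos_opTa_of_hypAC {q : ℝ} (h : HypAC q) {F G u : V5} (hF : InKE q F) (hG : InKE q G) (hu : InKE q u) {γ : Biv}
    (hγ : DualAB q γ) (h0 : pairH q (imgAB q F G u) γ = 0) : 0 ≤ pairH q (opTa (imgAB q F G u)) γ := by
  -- `∧²AC_x g = (1−x)²g + x(1−x)T_a g + x²W_a g` pairs `≥ 0` with `γ` for all `x ∈ (0,1]`; divide by `x` and let `x → 0`.
  set g := imgAB q F G u with hg
  have hW : 0 ≤ pairH q (opWa g) γ := by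
    rw [opWa_eq, pairH_smul_left]
    -- `g_yv ≥ 0`: pair `∧²AC_1 g = W_a g = g_yv e_yv`... instead use `x = 1` in `HypAC` directly
    have h1 := h F G u 1 hF hG hu zero_le_one le_rfl γ hγ
    have e : opAC 1 g = opWa g := by ext <;> simp [opAC, opTa, opWa, Biv.lin3, Biv.add, Biv.smul]
    rw [← hg, e, opWa_eq, pairH_smul_left] at h1
    exact h1
  have key : ∀ x : ℝ, 0 < x → x ≤ 1 → 0 ≤ (1 - x) * pairH q (opTa g) γ + x * pairH q (opWa g) γ := by
    intro x hx0 hx1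
    have hx := h F G u x hF hG hu hx0.le hx1 γ hγ
    rw [← hg, opAC, pairH_lin3, h0, mul_zero, zero_add] at hx
    have : x * (1 - x) * pairH q (opTa g) γ + x ^ 2 * pairH q (opWa g) γ = x * ((1 - x) * pairH q (opTa g) γ + x * pairH q (opWa g) γ) := by
      ring
    rw [this] at hx
    by_contra H
    push Not at H
    nlinarith [mul_pos hx0 (neg_pos.mpr H), hx]
  -- let `x → 0` along `x = 1/(n+2)`
  by_contra hA
  push Not at hA
  obtain ⟨n, hn⟩ := exists_nat_gt (pairH q (opWa g) γ / -pairH q (opTa g) γ)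
  have hx0 : (0 : ℝ) < 1 / ((n : ℝ) + 2) := by positivity
  have hx1 : 1 / ((n : ℝ) + 2) ≤ 1 := by
    rw [div_le_one (by positivity)]; linarith [n.cast_nonneg (α := ℝ)]
  have k := key _ hx0 hx1
  have hk : 0 ≤ ((n : ℝ) + 1) * pairH q (opTa g) γ + pairH q (opWa g) γ := by
    have e : ((n : ℝ) + 2) * ((1 - 1 / ((n : ℝ) + 2)) * pairH q (opTa g) γ + 1 / ((n : ℝ) + 2) * pairH q (opWa g) γ) =
        ((n : ℝ) + 1) * pairH q (opTa g) γ + pairH q (opWa g) γ := by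
      field_simp
      ring
    rw [← e]; exact mul_nonneg (by positivity) k
  have hB : pairH q (opWa g) γ < n * -pairH q (opTa g) γ := by rwa [div_lt_iff₀ (neg_pos.mpr hA)] at hn
  nlinarith [hk, hB, hA, n.cast_nonneg (α := ℝ)]

/-! ### The reduction: `HypAC` ⟹ the far cross-apex pair for every middle -/

/-- **`HypAC` ⟹ THE ALGEBRA-LEVEL FAR THEOREM** (`0 < q ≤ 1`): the hypothesis `halg` of `negCorr_spokes_cross_far_of_inKE`. [folklore] -/
theorem rayleigh_crossFar_of_hypAC {q : ℝ} (hq0 : 0 < q) (hq1 : q ≤ 1) (h : HypAC q) :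
    ∀ (mids : List (ℝ × ℝ × ℝ)), UnitBlocks mids → ∀ rd : ℝ, 0 ≤ rd → rd ≤ 1 → ∀ u s : V5, InKE q u → InKE q s →
      0 ≤ crossFarZ q mids rd u s 1 0 * crossFarZ q mids rd u s 0 1 - crossFarZ q mids rd u s 1 1 * crossFarZ q mids rd u s 0 0 := by
  intro mids hm rd hrd0 hrd1 u s hu hs
  have key := rayleigh_crossFar_of_isLetterCone (isLetterCone_coneAB h) hm hrd0 hrd1 (input_mem_coneAB hu)
    (pairH_coneAB_target hq0 hq1 hs)
  simp only [crossFarZ]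
  linarith [key]

open MeasureTheory Literature.Probability.LatticeModels Literature.Probability.Percolation
open scoped Classical

variable {V : Type*} [Fintype V]

section Setting

variable {a b : V} {c : ℕ → V} {m : ℕ}
variable (hab : a ≠ b) (hinj : ∀ j k, j ≤ m → k ≤ m → c j = c k → j = k) (hca : ∀ j, j ≤ m → c j ≠ a) (hcb : ∀ j, j ≤ m → c j ≠ b)
include hab hinj hca hcb

/-- **`HypAC` ⟹ NEGATIVE CORRELATION OF EVERY CROSS-APEX PAIR AT EVERY DISTANCE.**  If an `a`-spoke keeps the MULTIFAN₁ cone invariant at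
`q ∈ (0,1]`, then for every weighted double fan (`card V = m + 3`, weights supported on the double-fan pairs) and all `j < k ≤ m`:
`φ(J_{a c_j} ∩ J_{b c_k}) ≤ φ(J_{a c_j})·φ(J_{b c_k})`. [folklore] -/
theorem negCorr_spokes_cross_far_of_hypAC (hcard : Fintype.card V = m + 3) {q : ℝ} (hq0 : 0 < q) (hq1 : q ≤ 1)
    (w : Sym2 V → unitInterval) (hsupp : ∀ e, e ∉ dfPairs a b c m → w e = 0) (h : HypAC q) {j k : ℕ} (hjk : j < k) (hk : k ≤ m) :
    (rcMeasureW w q ∅).real ({ω : BondConfig V | s(a, c j) ∈ ω} ∩ {ω | s(b, c k) ∈ ω}) ≤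
      (rcMeasureW w q ∅).real {ω : BondConfig V | s(a, c j) ∈ ω} * (rcMeasureW w q ∅).real {ω : BondConfig V | s(b, c k) ∈ ω} :=
  negCorr_spokes_cross_far_of_inKE hab hinj hca hcb hcard hq0 w hsupp (rayleigh_crossFar_of_hypAC hq0 hq1 h) hjk hk

end Setting

end ThreeApex

end FK

end Summit.CriticalPhenomena.PercolationContinuityZ3.Theorems
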